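/-
Copyright (c) 2026 the pub-hodgecm-mathlib formalisation cell (harness21).  Prover seat hodgecm-mathlib-K2E3-p17 (g0), Track B «K2-LIT» ∕ h413, unit U5Kazhdan
of the line `K2_E3_EllipticInputs`: the WILD twin of E1 row B3(53)-RAM (the 17W∕15W∕16W∕18W engine, mechanical layer, file B3(53)-W).  2026-09-03.
-/
import Summits.HodgeConjecture.HodgeConjecture.Theorems.F0P3cStCharTSEllipticFixedTreeRamified   -- ★ 53-RAM p853453: the PLACE-FREE `_of_involution` heads (used BY NAME); brings ★ 53
import Summits.HodgeConjecture.HodgeConjecture.Theorems.F0P3cDyRamWildPlaceDatum                 -- ★ (LH4-p02): `exists_isRamifiedQuadraticDatum_of_placesOver`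
import Summits.HodgeConjecture.HodgeConjecture.Theorems.F0P3cDyRamWildTransitivity               -- ★ p854580 (LH4-p02): `htr₂_of_isRamifiedQuadraticDatum`; brings ★ htr₀-WILD `…_of_isSelfDualLattice_of_ramified`
import Literature.NumberTheory.Automorphic.UnitaryLatticeTreeEulerRelationWild                   -- ★ p854681 (LH4-p01): `isTree_latticeGraph_three_of_ramified`
import HarnessLib

/-!
# K2_E3 road (h413 = stmt-HodgeConjecture-24833), unit U5Kazhdan — THE WILD ENGINE, mechanical layer, FILE «B3(53)-W»: a regular elliptic `γ ∈ U(Φ₃)(L⁺_v)` has a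
# non-empty finite fixed tree in the lattice tree, AT EVERY RAMIFIED PLACE (tame re-proved, WILD = dyadic new)

Cell `pub/hodgecm-mathlib` (D-0151), Track B; seat K2E3-p17 (g0) (row #17; K2E3-plan (g1) DEALS BATCH #1 ∕ SYNC 22:07:32Z; K2E3-p21's tower census 22:06:26Z (c)
«EllipticFixedTreeWild first»).  THEOREMS ONLY (no definition ∕ instance ∕ notation ∕ named fact ∕ `sorry`); ★-only imports (never a `Cruxes/…/Lines` module).

WHAT.  The WILD twin of ★ 53-RAM `F0P3cStCharTSEllipticFixedTreeRamified` (p853453): its four tame dischargers re-issued with the tame block `(hσ hvσ hϖ hσϖ hres h2 hnorm)` ∕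
`(hσ hvσ hϖ h2)` replaced by `(he : e(w∣v) ≠ 1) (hϖ)` (ANY uniformiser `ϖ` of `L_w`, no `|2|_w` condition; ★ p855067's token map), conclusions VERBATIM, names
`…_of_ramificationIdx_ne_one`; proofs = the ★ PLACE-FREE `_of_involution` heads of ★ 53-RAM with the tree ★ `isTree_latticeGraph_three_of_ramified` (p854681), `htr₀` ★
`exists_unitary_mapGL_stdLattice_eq_of_isSelfDualLattice_of_ramified` (p854568) and `htr₂` ★ `htr₂_of_isRamifiedQuadraticDatum` (p854580), all read at Track A U0's RAMIFIED
QUADRATIC DATUM ★ `exists_isRamifiedQuadraticDatum_of_placesOver` (no parity ∕ tameness condition) — NO dependence on the horocycle step (S).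
* §1 `forall_isSelfDualLattice_exists_mapGL_stdLattice_eq_of_ramificationIdx_ne_one` · `exists_apply_eq_self_of_isCompact_centralizer_of_ramificationIdx_ne_one` ·
  `finite_setOf_apply_eq_self_of_isCompact_centralizer_of_ramificationIdx_ne_one` · `ellipticFixedTree_of_mem_ellG_of_ramificationIdx_ne_one` (the junction at the pins:
  for `γ ∈ 𝔇.ellG` the three 41g binders `hne`, `hfin`, `hfinE`).
Consumers: 48-W∕2 `K2E3EPFunctionOrbitalEllipticWild`, H-W, 58-W-W (⇒ 17W), 73-W ∕ X0′-W.

HONEST LABEL: HC_CM is proved only modulo the 7 printed citations (2 remaining named inputs: hLiu418 = stmt-HodgeConjecture-24832, h413 =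
stmt-HodgeConjecture-24833) until rung 0 closes; `--supports stmt-HodgeConjecture-24833` helper (a brick of row #17's wild residue); retires nothing by itself.

## References
* [Serre1980Trees] J.-P. Serre, *Trees* (1980): I.6.5 Prop. 26, II.1.1.
* [BruhatTits1972] F. Bruhat, J. Tits, *Groupes réductifs sur un corps local I*, Publ. Math. IHÉS 41 (1972): §10.
* [Kottwitz1986] R. E. Kottwitz, *Base change for unit elements of Hecke algebras*, Compositio Math. 60 (1986): §3.
* [Rogawski1990] J. D. Rogawski, *Automorphic Representations of Unitary Groups in Three Variables* (1990): §12.5 pp. 182–187.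
-/

set_option autoImplicit false
-- the mandated namespace has the single-problem summit's repeated segment (`HodgeConjecture.HodgeConjecture`)
set_option linter.dupNamespace false

noncomputable section

open NumberField IsDedekindDomain MeasureTheory
open scoped Pointwise Valued WithZero Matrix
open Literature.NumberTheory.Rogawski1990 Literature.NumberTheory.Rogawski1990.Ch12Sec5
open Literature.NumberTheory.Automorphic Literature.NumberTheory.Automorphic.UnitaryGroup Literature.NumberTheory.Automorphic.UnitaryLatticeTree
open Literature.NumberTheory.Automorphic.HermitianLattice
open Literature.Combinatorics.SimpleGraph Literature.Combinatorics.SimpleGraph.OrientedIncidence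
open Literature.NumberTheory.Automorphic.UnitaryThreeFourFrame

namespace Summit.HodgeConjecture.HodgeConjecture.Cruxes.H413.K2E3EllipticFixedTreeWild

open Summit.HodgeConjecture.HodgeConjecture.Cruxes.H413
open F0P3cStCharTSCharacterEllipticUniform F0P3cStCharTSTorusDefs F0P3cStCharTSEllipticFixedTree F0P3cStCharTSEllipticFixedTreeRamified
open F0P3cDyRamWildPlaceDatum F0P3cDyRamWildTransitivity

section Datum

variable (L : Type) [Field L] [NumberField L] [IsCMField L] (v : HeightOneSpectrum (𝓞 ↥(maximalRealSubfield L)))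
  (w : PlacesOver L v) (hw : IsCMField.complexConj L • w.1 = w.1) {ϖ : w.1.adicCompletion L}
  (eA : Gqs L v ≃ₜ* ↥(unitaryGroupOfForm (galAdicCompletionMap (L := L) (IsCMField.complexConj L) hw) ((StdForm.antidiagonal 3).over (w.1.adicCompletion L))))
  {a : Gqs L v →* ((latticeGraph (galAdicCompletionMap (L := L) (IsCMField.complexConj L) hw) ϖ ((StdForm.antidiagonal 3).over (w.1.adicCompletion L))) ≃g (latticeGraph (galAdicCompletionMap (L := L) (IsCMField.complexConj L) hw) ϖ ((StdForm.antidiagonal 3).over (w.1.adicCompletion L))))}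
  (ha : ∀ g, a g = latticeGraphIso (galAdicCompletionMap (L := L) (IsCMField.complexConj L) hw) ϖ ((StdForm.antidiagonal 3).over (w.1.adicCompletion L)) (eA g))

/-! ## §1 The WILD dischargers (`_of_ramificationIdx_ne_one`: `e(w∣v) ≠ 1`, ANY uniformiser, no condition on `|2|_w`; the heads of ★ 53 ∕ ★ 53-RAM
    `_of_involution` read at Track A U0's ramified quadratic datum) -/

omit eA ha in
/-- **SELF-DUAL TRANSITIVITY AT EVERY RAMIFIED PLACE** (tame re-proved, WILD new): every self-dual vertex lattice is `u·L₀` (★ htr₀-WILD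
`exists_unitary_mapGL_stdLattice_eq_of_isSelfDualLattice_of_ramified` at the datum ★ `exists_isRamifiedQuadraticDatum_of_placesOver`) — the `htr₀` letter of ★ 53-RAM §1.
[cite: BruhatTits1972, §10] -/
theorem forall_isSelfDualLattice_exists_mapGL_stdLattice_eq_of_ramificationIdx_ne_one
    (he : v.asIdeal.ramificationIdx' w.1.asIdeal ≠ 1) (hϖ : Valued.v ϖ = WithZero.exp (-1 : ℤ)) :
    ∀ M : Submodule 𝒪[(w.1.adicCompletion L)] (Fin 3 → (w.1.adicCompletion L)), IsSelfDualLattice (galAdicCompletionMap (L := L) (IsCMField.complexConj L) hw) ϖ ((StdForm.antidiagonal 3).over (w.1.adicCompletion L)) M →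
      ∃ u : ↥(unitaryGroupOfForm (galAdicCompletionMap (L := L) (IsCMField.complexConj L) hw) ((StdForm.antidiagonal 3).over (w.1.adicCompletion L))), M = mapGL (u : GL (Fin 3) (w.1.adicCompletion L)) (stdLattice (w.1.adicCompletion L) 3) := by
  letI : Fintype 𝓀[w.1.adicCompletion L] := Fintype.ofFinite _
  obtain ⟨nd, nt, hD⟩ := exists_isRamifiedQuadraticDatum_of_placesOver L w hw he ϖ hϖ
  obtain ⟨hσ, hvσ, -, heven, hd, h1d, h2t⟩ := hD
  exact exists_unitary_mapGL_stdLattice_eq_of_isSelfDualLattice_of_ramified hσ hvσ hϖ heven hd h1d h2t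

include ha in
/-- **`hne` AT EVERY RAMIFIED PLACE** (the tree by ★ `isTree_latticeGraph_three_of_ramified` at the datum). [cite: Serre1980Trees, I.6.5 Prop. 26] [cite: BruhatTits1972, §10]
[cite: Kottwitz1986, §3] -/
theorem exists_apply_eq_self_of_isCompact_centralizer_of_ramificationIdx_ne_one (he : v.asIdeal.ramificationIdx' w.1.asIdeal ≠ 1) (hϖ : Valued.v ϖ = WithZero.exp (-1 : ℤ))
    {γ : Gqs L v} (hZc : IsCompact ((Subgroup.centralizer ({γ} : Set (Gqs L v))) : Set (Gqs L v))) : ∃ o, a γ o = o := by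
  letI : Fintype 𝓀[w.1.adicCompletion L] := Fintype.ofFinite _
  obtain ⟨nd, nt, hD⟩ := exists_isRamifiedQuadraticDatum_of_placesOver L w hw he ϖ hϖ
  obtain ⟨hσ, hvσ, -, heven, hd, h1d, h2t⟩ := hD
  exact exists_apply_eq_self_of_isCompact_centralizer_of_involution L v w hw eA ha hvσ hϖ (isTree_latticeGraph_three_of_ramified hσ hvσ hϖ heven hd h1d h2t) hZc

include ha in
/-- **`hfin` AT EVERY RAMIFIED PLACE**: `htr₀` by §1's first theorem, `htr₂` by ★ `htr₂_of_isRamifiedQuadraticDatum`. [cite: Kottwitz1986, §3] [cite: BruhatTits1972, §10] -/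
theorem finite_setOf_apply_eq_self_of_isCompact_centralizer_of_ramificationIdx_ne_one (he : v.asIdeal.ramificationIdx' w.1.asIdeal ≠ 1) (hϖ : Valued.v ϖ = WithZero.exp (-1 : ℤ))
    {γ : Gqs L v} (hreg : IsRegularElt (γ.val : GL (Fin 3) (LocalRing L v))) (hZc : IsCompact ((Subgroup.centralizer ({γ} : Set (Gqs L v))) : Set (Gqs L v))) : {x : {M : Submodule 𝒪[(w.1.adicCompletion L)] (Fin 3 → (w.1.adicCompletion L)) // IsVertex (galAdicCompletionMap (L := L) (IsCMField.complexConj L) hw) ϖ ((StdForm.antidiagonal 3).over (w.1.adicCompletion L)) M} | a γ x = x}.Finite := by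
  letI : Fintype 𝓀[w.1.adicCompletion L] := Fintype.ofFinite _
  obtain ⟨nd, nt, hD⟩ := exists_isRamifiedQuadraticDatum_of_placesOver L w hw he ϖ hϖ
  obtain ⟨-, hvσ, -, -, -, -, -⟩ := id hD
  exact finite_setOf_apply_eq_self_of_isCompact_centralizer_of_involution L v w hw eA ha hvσ hϖ
    (forall_isSelfDualLattice_exists_mapGL_stdLattice_eq_of_ramificationIdx_ne_one L v w hw he hϖ)
    (htr₂_of_isRamifiedQuadraticDatum hD) hreg hZc

set_option maxHeartbeats 800000 in
-- the junction's `exact` re-elaborates the three-clause conclusion over the datum-derived letters (as ★ 53-RAM §1's budget line)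
include ha in
/-- **THE JUNCTION AT THE PINS AT EVERY RAMIFIED PLACE**: for `γ ∈ 𝔇.ellG`, the three 41g binders `hne`, `hfin`, `hfinE` with NO hypothesis-style residue beyond the two place
letters `he hϖ`. [cite: Rogawski1990, §12.5 pp. 182–187] [cite: Kottwitz1986, §3] -/
theorem ellipticFixedTree_of_mem_ellG_of_ramificationIdx_ne_one (hns : ∀ w' : PlacesOver L v, IsCMField.complexConj L • w'.1 = w'.1) (he : v.asIdeal.ramificationIdx' w.1.asIdeal ≠ 1) (hϖ : Valued.v ϖ = WithZero.exp (-1 : ℤ))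
    (τ : Orientation (latticeGraph (galAdicCompletionMap (L := L) (IsCMField.complexConj L) hw) ϖ ((StdForm.antidiagonal 3).over (w.1.adicCompletion L)))) (hτ : ∀ d, τ.tail d < τ.head d)
    [MeasurableSpace (Gqs L v)]
    [∀ γ : Gqs L v, MeasurableSpace (Gqs L v ⧸ Subgroup.centralizer ({γ} : Set (Gqs L v)))] [MeasurableSpace (Gqs L v ⧸ Subgroup.center (Gqs L v))]
    {H' : Type} [Group H'] [TopologicalSpace H'] [IsTopologicalGroup H'] [MeasurableSpace H']
    (𝔇 : EllipticData (Gqs L v) H')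
    (hE : ∀ γ : Gqs L v, γ ∈ 𝔇.ellG ↔ IsRegularElt (γ.val : GL (Fin 3) (UnitaryGroup.LocalRing L v)) ∧ γ ∉ hyperbolicSet L v)
    {γ : Gqs L v} (hγ : γ ∈ 𝔇.ellG) :
    (∃ o, a γ o = o) ∧ {x : {M : Submodule 𝒪[(w.1.adicCompletion L)] (Fin 3 → (w.1.adicCompletion L)) // IsVertex (galAdicCompletionMap (L := L) (IsCMField.complexConj L) hw) ϖ ((StdForm.antidiagonal 3).over (w.1.adicCompletion L)) M} | a γ x = x}.Finite ∧ {d : (latticeGraph (galAdicCompletionMap (L := L) (IsCMField.complexConj L) hw) ϖ ((StdForm.antidiagonal 3).over (w.1.adicCompletion L))).edgeSet | (a γ).mapEdgeSet d = d}.Finite := by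
  letI : Fintype 𝓀[w.1.adicCompletion L] := Fintype.ofFinite _
  obtain ⟨nd, nt, hD⟩ := exists_isRamifiedQuadraticDatum_of_placesOver L w hw he ϖ hϖ
  obtain ⟨hσ, hvσ, -, heven, hd, h1d, h2t⟩ := id hD
  exact ellipticFixedTree_of_mem_ellG_of_involution L v w hw eA ha hns hvσ hϖ (isTree_latticeGraph_three_of_ramified hσ hvσ hϖ heven hd h1d h2t)
    (forall_isSelfDualLattice_exists_mapGL_stdLattice_eq_of_ramificationIdx_ne_one L v w hw he hϖ)
    (htr₂_of_isRamifiedQuadraticDatum hD) τ hτ 𝔇 hE hγ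

end Datum

end Summit.HodgeConjecture.HodgeConjecture.Cruxes.H413.K2E3EllipticFixedTreeWild

end
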